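import Mathlib
import Summits.PneNP.PneNP.Theorems.ConvexRankGatesConvexGateBlindColumnSpaceBlind

/-!
# PneNP / ConvexRankGates — `ConvexGateBlind`: ε-sensitivity costs at least one term (`R ≥ C(m,2) + 1`)

Helpers (`--supports stmt-PneNP-10680`), COLUMN-SPACE line (prover seat 2, session 13) — the corollary for UNRESTRICTED
non-negative factorisations of the LP slice of the crux.

At `ε = 0` the one-sided clique-distance matrix factorises trivially with `C(m,2)` non-negative terms,
`cdist Q u = ∑_e [e ⊆ Q]·[e ∉ u]`, and `C(m,2)` is also its rank (the pair-inclusion map `X` is injective,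
`eq_zero_of_cliqueSum_eq_zero`, and the columns `u = ∅`, `u = {e}` already span `X(ℝ^E)`). A factorisation of
`cdist Q u − ε` with `R ≤ C(m,2)` terms is therefore RANK-TIGHT: its row objects span exactly the column space `X(ℝ^E)`,
i.e. it is restricted in the sense of `…ColumnSpaceBlind.lean` (`exists_edgeWeighting_of_card_le`, a finrank squeeze),
and the column-space theorem kills it. Hence:

* `lpSlice_terms_gt_choose_two` (stub `lpSlice_rank_plus_one`) — **for every `δ ∈ (0,1/11)`, eventually in `m`, for every
  `ε > 0`: every non-negative factorisation `cdist Q u − ε = ∑_{l < R} U_l(u) V_l(Q)` (`U ≥ 0`, `V_l ≥ 0` on `k`-sets, all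
  `k`-sets `Q`, all `k`-clique-free `u`, `k = ⌈m^δ⌉₊`) has `R ≥ C(m,2) + 1` terms.** In the language of Hrubeš (2020):
  `rk₊(D − εJ) > rk(D) = rk₊(D)` for all small `ε > 0` — the first lower bound for this explicit matrix that USES `ε > 0`
  (for `ε = 0`, `C(m,2)` terms suffice), i.e. the weakest quantitative form of ε-sensitivity, in the crux's quantifier order.
[new]
-/

set_option linter.dupNamespace false

namespace Summit.PneNP.PneNP.Theorems

open Finset Real Filter Literature.Computability.Complexity
open Summit.PneNP.PneNP.Cruxes.ConvexGateBlind.StrictRankConicCover (Edge cdist)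

noncomputable section

variable {m : ℕ}

/-! ## Two clique-free test graphs: the empty graph and a single edge -/

/-- A graph contained in a complete bipartite graph is `k`-clique-free for `3 ≤ k`; in particular the empty graph and a
single edge are. [folklore] -/
theorem cliqueFn_eq_false_of_le_colorVec {k : ℕ} (hk : 3 ≤ k) (u : Edge m → Bool) (h : Fin m → Fin 2)
    (hle : ∀ e, u e = true → colorVec h e = true) : cliqueFn m k u = false := by
  have hcol : cliqueFn m k (colorVec h) = false := cliqueFn_colorVec h (by omega)
  rw [cliqueFn_eq_false_iff] at hcol ⊢
  refine hcol.anti (cliqueGraph_mono fun e => ?_)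
  rcases Bool.eq_false_or_eq_true (u e) with hu | hu
  · rw [hu, hle e hu]
  · rw [hu]; exact Bool.false_le _

/-- The empty graph is `k`-clique-free (`3 ≤ k`). [folklore] -/
theorem cliqueFn_empty_eq_false {k : ℕ} (hk : 3 ≤ k) : cliqueFn m k (fun _ : Edge m => false) = false :=
  cliqueFn_eq_false_of_le_colorVec hk _ (fun _ => 0) (fun _ h => absurd h (by simp))

/-- A single edge is `k`-clique-free (`3 ≤ k`). [folklore] -/
theorem cliqueFn_single_eq_false {k : ℕ} (hk : 3 ≤ k) (e : Edge m) :
    cliqueFn m k (fun f : Edge m => decide (f = e)) = false := by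
  classical
  obtain ⟨z, hz⟩ := e
  induction z using Sym2.ind with
  | h a b =>
    have hab : a ≠ b := by simpa using hz
    refine cliqueFn_eq_false_of_le_colorVec hk _ (fun x => if x = a then 0 else 1) (fun f hf => ?_)
    rw [decide_eq_true_eq] at hf
    subst hf
    have : ¬ ((if a = a then (0 : Fin 2) else 1) = (if b = a then (0 : Fin 2) else 1)) := by
      rw [if_pos rfl, if_neg (Ne.symm hab)]; exact Fin.zero_ne_one
    simpa [colorVec] using this

/-- `cdist Q ∅ − cdist Q {e} = [e ⊆ Q]`: the empty column minus a one-edge column is a pair indicator. [folklore] -/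
theorem cdist_empty_sub_cdist_single (Q : Finset (Fin m)) (e : Edge m) :
    cdist Q (fun _ => false) - cdist Q (fun f => decide (f = e)) = if cliqueVec Q e = true then 1 else 0 := by
  classical
  unfold cdist
  rw [← Finset.sum_sub_distrib]
  rw [Finset.sum_eq_single e]
  · by_cases hQ : cliqueVec Q e = true <;> simp [hQ]
  · intro f _ hfe
    by_cases hQ : cliqueVec Q f = true <;> simp [hQ, hfe]
  · intro h; exact absurd (Finset.mem_univ e) h

/-! ## Rank-tight factorisations are restricted -/

/-- **Rank-tight ⟹ restricted.** If `cdist Q u − ε = ∑_{l<R} U_l(u) V_l(Q)` for all `k`-sets `Q` and all `k`-clique-free `u`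
(`3 ≤ k`, `k + 2 ≤ m`) with `R ≤ C(m,2)`, then every row object is a clique sum on `k`-sets: `V_l(Q) = t_l(E(Q))` for some
edge weighting `t_l`. (The `C(m,2)`-dimensional space `X(ℝ^E)` — `X` injective by `eq_zero_of_cliqueSum_eq_zero` — is
spanned by the columns `u = ∅, {e}` and lies in `span{V_l}`, of dimension `≤ R ≤ C(m,2)`; so the two coincide.) [new] -/
theorem exists_edgeWeighting_of_card_le {k R : ℕ} (hk : 3 ≤ k) (hkm : k + 2 ≤ m) (ε : ℝ)
    (U : (Edge m → Bool) → Fin R → ℝ) (V : Fin R → Finset (Fin m) → ℝ)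
    (hfact : ∀ (Q : Finset (Fin m)) (u : Edge m → Bool), Q.card = k → cliqueFn m k u = false →
      cdist Q u - ε = ∑ l, U u l * V l Q)
    (hR : R ≤ m.choose 2) (l : Fin R) :
    ∃ t : Edge m → ℝ, ∀ Q : Finset (Fin m), Q.card = k → V l Q = ∑ e, (if cliqueVec Q e = true then t e else 0) := by
  classical
  -- the pair-inclusion map on `k`-sets
  set X : (Edge m → ℝ) →ₗ[ℝ] ({Q : Finset (Fin m) // Q.card = k} → ℝ) :=
    { toFun := fun t Q => ∑ e, (if cliqueVec Q.1 e = true then t e else 0)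
      map_add' := fun t t' => by
        funext Q
        simp only [Pi.add_apply, ← Finset.sum_add_distrib]
        exact Finset.sum_congr rfl fun e _ => by split_ifs <;> simp
      map_smul' := fun a t => by
        funext Q
        simp only [Pi.smul_apply, smul_eq_mul, RingHom.id_apply, Finset.mul_sum]
        exact Finset.sum_congr rfl fun e _ => by split_ifs <;> simp } with hX
  have hXapply : ∀ (t : Edge m → ℝ) (Q : {Q : Finset (Fin m) // Q.card = k}),
      X t Q = ∑ e, (if cliqueVec Q.1 e = true then t e else 0) := fun t Q => rfl
  have hXinj : Function.Injective X := by
    intro t t' h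
    have h0 := eq_zero_of_cliqueSum_eq_zero (k := k) (by omega) hkm (t - t') fun Q hQ => by
      have h' := congrFun h ⟨Q, hQ⟩
      rw [hXapply, hXapply] at h'
      rw [← sub_eq_zero, ← Finset.sum_sub_distrib] at h'
      refine Eq.trans (Finset.sum_congr rfl fun e _ => ?_) h'
      simp only [Pi.sub_apply]
      split_ifs <;> simp
    exact sub_eq_zero.1 h0
  -- the span of the row objects
  set S : Submodule ℝ ({Q : Finset (Fin m) // Q.card = k} → ℝ) :=
    Submodule.span ℝ (Set.range fun l : Fin R => fun Q : {Q : Finset (Fin m) // Q.card = k} => V l Q.1) with hS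
  have hVmem : ∀ l : Fin R, (fun Q : {Q : Finset (Fin m) // Q.card = k} => V l Q.1) ∈ S :=
    fun l => Submodule.subset_span ⟨l, rfl⟩
  -- columns of clique-free graphs lie in `S`
  have hcol : ∀ u : Edge m → Bool, cliqueFn m k u = false →
      (fun Q : {Q : Finset (Fin m) // Q.card = k} => cdist Q.1 u - ε) ∈ S := by
    intro u hu
    have : (fun Q : {Q : Finset (Fin m) // Q.card = k} => cdist Q.1 u - ε) =
        ∑ l, U u l • (fun Q : {Q : Finset (Fin m) // Q.card = k} => V l Q.1) := by
      funext Q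
      rw [hfact Q.1 u Q.2 hu, Finset.sum_apply]
      rfl
    rw [this]
    exact Submodule.sum_mem _ fun l _ => Submodule.smul_mem _ _ (hVmem l)
  -- hence `range X ≤ S`
  have hrange : LinearMap.range X ≤ S := by
    rintro _ ⟨t, rfl⟩
    rw [← Finset.univ_sum_single t, map_sum]
    refine Submodule.sum_mem _ fun e _ => ?_
    have hse : Pi.single e (t e) = t e • (Pi.single e (1 : ℝ) : Edge m → ℝ) := by
      rw [← Pi.single_smul, smul_eq_mul, mul_one]
    rw [hse, LinearMap.map_smul]
    refine Submodule.smul_mem _ _ ?_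
    have hXe : X (Pi.single e (1 : ℝ)) = (fun Q : {Q : Finset (Fin m) // Q.card = k} => cdist Q.1 (fun _ => false) - ε) -
        (fun Q => cdist Q.1 (fun f => decide (f = e)) - ε) := by
      funext Q
      rw [Pi.sub_apply, hXapply, sub_sub_sub_cancel_right, cdist_empty_sub_cdist_single, Finset.sum_eq_single e]
      · simp
      · intro f _ hfe; rw [Pi.single_eq_of_ne hfe]; simp
      · intro h; exact absurd (Finset.mem_univ e) h
    rw [hXe]
    exact Submodule.sub_mem _ (hcol _ (cliqueFn_empty_eq_false hk)) (hcol _ (cliqueFn_single_eq_false hk e))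
  -- finrank squeeze: `range X = S`
  have hfr : Module.finrank ℝ (LinearMap.range X) = m.choose 2 := by
    rw [LinearMap.finrank_range_of_inj hXinj, Module.finrank_fintype_fun_eq_card,
      Literature.Computability.Complexity.card_edgeSet_top_fin]
  have hfS : Module.finrank ℝ S ≤ R := by
    have h := finrank_range_le_card (R := ℝ) (fun l : Fin R => fun Q : {Q : Finset (Fin m) // Q.card = k} => V l Q.1)
    rw [Fintype.card_fin] at h
    exact h
  have heq : LinearMap.range X = S :=
    Submodule.eq_of_le_of_finrank_le hrange (by rw [hfr]; exact hfS.trans hR)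
  -- read off `t_l`
  have hl : (fun Q : {Q : Finset (Fin m) // Q.card = k} => V l Q.1) ∈ LinearMap.range X := heq ▸ hVmem l
  obtain ⟨t, ht⟩ := hl
  refine ⟨t, fun Q hQ => ?_⟩
  have := congrFun ht ⟨Q, hQ⟩
  rw [hXapply] at this
  exact this.symm

/-! ## The eventual form -/

/-- **ε-sensitivity costs at least one term.** For every `δ ∈ (0, 1/11)`, eventually in `m` (`k = ⌈m^δ⌉₊`), for every
`ε > 0` and every `R ≤ C(m,2)`: there is NO non-negative factorisation `cdist Q u − ε = ∑_{l<R} U_l(u) V_l(Q)` (`U ≥ 0`,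
`V_l ≥ 0` on `k`-sets) valid for all `k`-sets `Q` and all `k`-clique-free `u`. So every non-negative factorisation of the
LP slice of the crux has at least `C(m,2) + 1 = rank + 1` terms, for every `ε > 0` — whereas `ε = 0` needs only `C(m,2)`. [new] -/
theorem lpSlice_terms_gt_choose_two {δ : ℝ} (hδ0 : 0 < δ) (hδ1 : δ < 1 / 11) :
    ∀ᶠ m : ℕ in atTop, ∀ ε : ℝ, 0 < ε → ∀ R : ℕ, R ≤ m.choose 2 →
      ∀ (U : (Edge m → Bool) → Fin R → ℝ) (V : Fin R → Finset (Fin m) → ℝ),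
      (∀ u l, 0 ≤ U u l) → (∀ l (Q : Finset (Fin m)), Q.card = ⌈(m : ℝ) ^ δ⌉₊ → 0 ≤ V l Q) →
      ¬ ∀ (Q : Finset (Fin m)) (u : Edge m → Bool), Q.card = ⌈(m : ℝ) ^ δ⌉₊ → cliqueFn m ⌈(m : ℝ) ^ δ⌉₊ u = false →
          cdist Q u - ε = ∑ l, U u l * V l Q := by
  filter_upwards [columnSpace_cliqueDistConeRankHard hδ0 hδ1 2, eventually_catch_exponent hδ0 hδ1 0] with m hcol hk
  obtain ⟨hk4, hkm, -⟩ := hk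
  intro ε hε R hR U V hU hV hall
  have hkm2 : ⌈(m : ℝ) ^ δ⌉₊ + 2 ≤ m := by omega
  choose t ht using fun l => exists_edgeWeighting_of_card_le (by omega) hkm2 ε U V hall hR l
  refine hcol ε hε R (hR.trans (Nat.choose_le_pow m 2)) t U (fun l Q hQ => ?_) hU (fun Q u hQ hu => ?_)
  · rw [← ht l Q hQ]; exact hV l Q hQ
  · rw [hall Q u hQ hu]
    exact Finset.sum_congr rfl fun l _ => by rw [ht l Q hQ]

/-- **The same in the `ConeFactorisable` vocabulary of the strict-rank line** (`q = 0` PSD part, constant potential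
`a ≡ ε`, `b ≡ 1`): for `δ ∈ (0,1/11)`, eventually in `m`, for every `ε > 0` and every `r ≤ C(m,2)`,
`¬ ConeFactorisable m ⌈m^δ⌉₊ 0 r (fun _ => ε) (fun _ => 1)` — compare `unitPotentialHard_lp` (seat 0: `ε = 1`, all
`r ≤ m^c`, `δ = 1/2`): here ALL `ε > 0`, but only `r ≤ C(m,2) = rank`. [new] -/
theorem not_coneFactorisable_le_choose_two {δ : ℝ} (hδ0 : 0 < δ) (hδ1 : δ < 1 / 11) :
    ∀ᶠ m : ℕ in atTop, ∀ ε : ℝ, 0 < ε → ∀ r : ℕ, r ≤ m.choose 2 →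
      ¬ Summit.PneNP.PneNP.Cruxes.ConvexGateBlind.StrictRankConicCover.ConeFactorisable m ⌈(m : ℝ) ^ δ⌉₊ 0 r
        (fun _ => ε) (fun _ => 1) := by
  filter_upwards [lpSlice_terms_gt_choose_two hδ0 hδ1] with m hm
  intro ε hε r hr hcf
  obtain ⟨H, Y, U, V, -, -, hU, hV, hall⟩ := hcf
  refine hm ε hε r hr U V hU (fun l Q _ => hV l Q) fun Q u hQ hu => ?_
  have h := hall Q u hQ hu
  rw [Matrix.trace, Fintype.sum_empty, zero_add, mul_one] at h
  exact h

/-- **ε-sensitivity costs at least one term** (registered form of `lpSlice_terms_gt_choose_two`). [new] -/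
theorem lpSlice_rank_plus_one : ∀ (δ : ℝ), 0 < δ → δ < 1 / 11 → ∀ᶠ m : ℕ in Filter.atTop, ∀ ε : ℝ, 0 < ε → ∀ R : ℕ, R ≤ m.choose 2 → ∀ (U : (Edge m → Bool) → Fin R → ℝ) (V : Fin R → Finset (Fin m) → ℝ), (∀ u l, 0 ≤ U u l) → (∀ l (Q : Finset (Fin m)), Q.card = ⌈(m : ℝ) ^ δ⌉₊ → 0 ≤ V l Q) → ¬ ∀ (Q : Finset (Fin m)) (u : Edge m → Bool), Q.card = ⌈(m : ℝ) ^ δ⌉₊ → cliqueFn m ⌈(m : ℝ) ^ δ⌉₊ u = false → cdist Q u - ε = ∑ l, U u l * V l Q :=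
  fun _ hδ0 hδ1 => lpSlice_terms_gt_choose_two hδ0 hδ1

end

end Summit.PneNP.PneNP.Theorems
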